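import Summits.RiemannHypothesis.RiemannHypothesis.Theses.SpectralTrace
import Summits.RiemannHypothesis.RiemannHypothesis.Theorems.SpectralTraceWindowCompactness
import Summits.RiemannHypothesis.RiemannHypothesis.Theorems.SpectralTraceFloorFeedbackDefs
import Summits.RiemannHypothesis.RiemannHypothesis.Theorems.SpectralTraceWindowStepStubBandExclusion
import Summits.RiemannHypothesis.RiemannHypothesis.Theorems.SpectralTraceWindowStepStubCrossingSum
import Summits.RiemannHypothesis.RiemannHypothesis.Theorems.SpectralTraceWindowStepStubTraceAssembly
import Summits.RiemannHypothesis.RiemannHypothesis.Theorems.SpectralTraceWindowStepStubSlopeAbove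
import Summits.RiemannHypothesis.RiemannHypothesis.Theorems.SpectralTraceWindowStepStubModelDensity
import Summits.RiemannHypothesis.RiemannHypothesis.Theorems.SpectralTraceWindowStepStubModelRegular
import HarnessLib

/-!
# Floor–feedback quantisation: exact synthesis from quiet solutions (the line's engine, assembled; lead session 1)

Route `RiemannHypothesis/SpectralTrace`, crux `WindowStep` (stmt-RiemannHypothesis-14659), line `floor-feedback`
(skeleton `Cruxes/WindowStep/Lines/floor_feedback.lean`).  The six RH-free stubs of the line are landed
(`stub_modelDensity` p98320, `stub_modelRegular` p98679, `stub_bandExclusion` p97849, `stub_crossingSum` p98153,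
`stub_traceAssembly` p98459, `stub_slopeAbove` p97948); this file assembles them into the UNCONDITIONAL theorems that
calibrate the line's one held (RH-strength-or-false) stub `∀ n ≥ 2, QuietRung (log n)`:

* `wtrace_of_quietSolution` — for ANY window density `ρ` at level `A > 0` (continuous, `O(log)`, density floor from
  `T₀ ≥ 1` on) with primitive `Φ`, ANY admissible kernel `k` (`𝓕k ≡ 1` on `|w| ≤ A/2π`) and ANY continuous solution `h` of
  the floor–feedback equation `h = k ⋆ fract(Φ + h)` whose integer count `⌊Φ + h⌋` is monotone on
  `[-handover T₀ C k, handover T₀ C k]`: the first crossings of `Φ + h` are an exact unit-multiplicity real family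
  reproducing `W` on the Weil tests supported in `[-A, A]` (`WTrace A`).  Mechanism: Bernstein (`stub_slopeAbove`) makes
  `Φ + h` strictly increasing beyond the handover height, gluing gives a monotone integer count on `ℝ`, and the exact
  synthesis theorem K2⁺ (`stub_traceAssembly` fed with `stub_bandExclusion`, `stub_crossingSum`) gives the `HasSum`.
* `wtrace_of_quietRung` — a quiet rung over the EXPLICIT model count (`QuietRung A`, definitions file
  `SpectralTraceFloorFeedbackDefs`) is an exact rung family `Trace(A)` (adds the model package `stub_modelDensity`,
  `stub_modelRegular`).
* `windowTraceArch_of_quietRung_two : QuietRung (log 2) → WindowTraceArch` and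
  `windowTracePrime2_of_quietRung_three : QuietRung (log 3) → WindowTracePrime2` — the two sibling cruxes of the route
  follow from single instances of the held stub.
* `riemannHypothesis_of_quietLadder`, `windowStep_of_quietLadder` — the quiet ladder proves RH and hence the crux
  (`riemannHypothesis_of_ladder`, `spectralThesis_of_riemannHypothesis`): the line's transfer `C⁺ → WindowStep`,
  kernel-checked, RH entering openly as Collapse (`Theorems/WindowStep/Negative/Collapse.lean`) says it must.

Nothing here is conditional on an unproved fact; the quiet hypotheses appear in the TYPES.  What is NOT here: any claim that
a quiet solution exists (that is the held stub, numerically under attack by both lead seats); the small a-priori facts about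
quiet objects (`|h| ≤ ‖k‖₁`, bounded discrepancy, Bernstein floor `A ≤ ‖k′‖₁`, `quietHeight ≥ e^{2πC⋆+πA}`) are the co-lead's
file `SpectralTraceWindowStepQuietCalibration.lean` (p97431) and are not re-derived here.
-/

set_option linter.dupNamespace false

noncomputable section

open Complex Filter Set MeasureTheory
open scoped Real Topology BigOperators FourierTransform SchwartzMap

namespace Summit.RiemannHypothesis.RiemannHypothesis.Theorems.SpectralTraceWindowStep

open Literature.NumberTheory.LFunctions
open Summit.RiemannHypothesis.RiemannHypothesis.Theses.SpectralTrace
open Summit.RiemannHypothesis.RiemannHypothesis.Theorems.FloorFeedback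

/-- GLUING: monotonicity of the integer count of `G` on `[-T₁, T₁]` and strict monotonicity of `G` on the two rays beyond
`T₁ ≥ 0` give a monotone integer count on `ℝ`. [folklore] -/
theorem quietCalibration_monotone_floor {G : ℝ → ℝ} {T₁ : ℝ} (hT₁ : 0 ≤ T₁)
    (hmid : MonotoneOn (fun T => ⌊G T⌋) (Icc (-T₁) T₁))
    (hup : StrictMonoOn G (Ici T₁)) (hdown : StrictMonoOn G (Iic (-T₁))) :
    Monotone fun T => ⌊G T⌋ := by
  have m1 : MonotoneOn (fun T => ⌊G T⌋) (Ici T₁) :=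
    fun a ha b hb hab => Int.floor_le_floor (hup.monotoneOn ha hb hab)
  have m2 : MonotoneOn (fun T => ⌊G T⌋) (Iic (-T₁)) :=
    fun a ha b hb hab => Int.floor_le_floor (hdown.monotoneOn ha hb hab)
  have hle : -T₁ ≤ T₁ := by linarith
  have m01 : MonotoneOn (fun T => ⌊G T⌋) (Icc (-T₁) T₁ ∪ Ici T₁) :=
    MonotoneOn.union_right hmid m1 (isGreatest_Icc hle) isLeast_Ici
  rw [Icc_union_Ici_eq_Ici hle] at m01
  exact MonotoneOn.Iic_union_Ici m2 m01

/-- **EXACT SYNTHESIS FROM ANY QUIET SOLUTION (unconditional).** For a window density `ρ` at level `A > 0` (continuous,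
`O(log)`, with a density floor from `T₀ ≥ 1` on) with primitive `Φ`, an admissible kernel `k` and a floor–feedback solution
`h` whose integer count is monotone on `[-T₁, T₁]`, `T₁ = handover T₀ C k`: the first crossings form an exact rung family
`Trace(A)`.  (Bernstein p97948 + gluing + K2⁺ p97849/p98153/p98459.) [folklore] -/
theorem wtrace_of_quietSolution {A : ℝ} (hA : 0 < A) {Φ ρ h : ℝ → ℝ} {k : 𝓢(ℝ, ℝ)} {T₀ C : ℝ}
    (hT₀ : 1 ≤ T₀) (hwd : IsWindowDensity A ρ) (hcont : Continuous ρ) (hderiv : ∀ T : ℝ, HasDerivAt Φ (ρ T) T)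
    (hlog : ∃ C' : ℝ, ∀ T : ℝ, |ρ T| ≤ C' * Real.log (2 + |T|)) (hfloor : DensityFloor ρ T₀ C)
    (hk : IsFeedbackKernel A k) (hfb : IsFloorFeedback Φ h k)
    (hmono : MonotoneOn (fun T : ℝ => ⌊Φ T + h T⌋) (Icc (-handover T₀ C k) (handover T₀ C k))) : WTrace A := by
  obtain ⟨-, hup, hdown, htop, hbot⟩ := stub_slopeAbove Φ ρ h k T₀ C hT₀ hderiv hfloor hfb.1 hfb.2
  have hall : Monotone fun T : ℝ => ⌊Φ T + h T⌋ :=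
    quietCalibration_monotone_floor (G := fun T => Φ T + h T) (handover_pos _ _ _).le hmono hup hdown
  exact stub_traceAssembly stub_bandExclusion stub_crossingSum A Φ ρ h k hA hwd hcont hderiv hlog hk hfb.1 hfb.2 hall
    htop hbot

/-- Registered lead helper `quietSolution_imp_wtrace` (the statement of `wtrace_of_quietSolution` in `∀` form).
[folklore] -/
theorem quietSolution_imp_wtrace : ∀ (A : ℝ) (Φ ρ h : ℝ → ℝ) (k : 𝓢(ℝ, ℝ)) (T₀ C : ℝ), 0 < A → 1 ≤ T₀ → IsWindowDensity A ρ → Continuous ρ → (∀ T : ℝ, HasDerivAt Φ (ρ T) T) → (∃ C' : ℝ, ∀ T : ℝ, |ρ T| ≤ C' * Real.log (2 + |T|)) → DensityFloor ρ T₀ C → IsFeedbackKernel A k → IsFloorFeedback Φ h k → MonotoneOn (fun T : ℝ => ⌊Φ T + h T⌋) (Icc (-handover T₀ C k) (handover T₀ C k)) → WTrace A :=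
  fun _ _ _ _ _ _ _ hA hT₀ hwd hcont hderiv hlog hfloor hk hfb hmono =>
    wtrace_of_quietSolution hA hT₀ hwd hcont hderiv hlog hfloor hk hfb hmono

/-- **ONE RUNG (unconditional): a quiet rung at level `A > 0` is an exact rung family `Trace(A)`** (explicit model package
p98320/p98679 + `wtrace_of_quietSolution`). [folklore] -/
theorem wtrace_of_quietRung {A : ℝ} (hA : 0 < A) (hq : QuietRung A) : WTrace A := by
  obtain ⟨h, k, hk, hfb, hmono⟩ := hq
  obtain ⟨hcont, hderiv, hlog, h1, hfloor⟩ := stub_modelRegular A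
  exact wtrace_of_quietSolution hA h1 (stub_modelDensity A hA) hcont hderiv hlog hfloor hk hfb hmono

/-- Registered lead helper `quietRung_imp_wtrace`: `∀ A > 0, QuietRung A → WTrace A`. [folklore] -/
theorem quietRung_imp_wtrace : ∀ A : ℝ, 0 < A → QuietRung A → WTrace A :=
  fun _ hA hq => wtrace_of_quietRung hA hq

/-- **`QuietRung (log 2) → WindowTraceArch` (unconditional):** the `n = 2` instance of the line's held stub already gives
the archimedean rung, the tier-deciding sibling crux `stmt-RiemannHypothesis-11195`. [folklore] -/
theorem windowTraceArch_of_quietRung_two (hq : QuietRung (Real.log 2)) : WindowTraceArch :=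
  wtrace_of_quietRung (Real.log_pos (by norm_num)) hq

/-- Registered lead helper `quietRung_two_imp_windowTraceArch`. [folklore] -/
theorem quietRung_two_imp_windowTraceArch : QuietRung (Real.log 2) → WindowTraceArch :=
  windowTraceArch_of_quietRung_two

/-- **`QuietRung (log 3) → WindowTracePrime2` (unconditional):** the `n = 3` instance gives the first prime rung, the sibling
crux `stmt-RiemannHypothesis-11196`. [folklore] -/
theorem windowTracePrime2_of_quietRung_three (hq : QuietRung (Real.log 3)) : WindowTracePrime2 :=
  wtrace_of_quietRung (Real.log_pos (by norm_num)) hq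

/-- **The quiet ladder proves RH** (exact rungs at every integer level dominate every window; then
`riemannHypothesis_of_ladder`). [folklore] -/
theorem riemannHypothesis_of_quietLadder (hL : ∀ n : ℕ, 2 ≤ n → QuietRung (Real.log n)) :
    _root_.RiemannHypothesis := by
  have hr : ∀ n : ℕ, 2 ≤ n → WTrace (Real.log n) := fun n hn =>
    wtrace_of_quietRung (Real.log_pos (by exact_mod_cast (by omega : 1 < n))) (hL n hn)
  refine Summit.RiemannHypothesis.RiemannHypothesis.Theorems.riemannHypothesis_of_ladder fun A _ => ?_
  obtain ⟨n, hn⟩ := exists_nat_ge (Real.exp A)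
  obtain ⟨ι, γ, hγ⟩ := hr (n + 2) (by omega)
  have hpos : (0 : ℝ) < ((n + 2 : ℕ) : ℝ) := by positivity
  have hAn : A ≤ Real.log ((n + 2 : ℕ) : ℝ) := by
    rw [Real.le_log_iff_exp_le hpos]
    push_cast
    linarith
  exact ⟨ι, γ, fun g hg hgs => hγ g hg (hgs.trans (Icc_subset_Icc (neg_le_neg hAn) hAn))⟩

/-- **The line's transfer `C⁺ → WindowStep`, kernel-checked:** the quiet ladder (= the planner's `QuietSeed ∧ QuietStep`)
implies the crux — through RH, openly (`spectralThesis_of_riemannHypothesis`), i.e. the `←` direction of the landed Collapse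
lemma.  The hypothesis is the line's one held stub; this theorem does NOT assert it. [folklore] -/
theorem windowStep_of_quietLadder (hL : ∀ n : ℕ, 2 ≤ n → QuietRung (Real.log n)) : WindowStep := by
  have hRH : _root_.RiemannHypothesis := riemannHypothesis_of_quietLadder hL
  intro n _ _
  obtain ⟨ι, γ, hγ⟩ :=
    Summit.RiemannHypothesis.RiemannHypothesis.Theorems.spectralThesis_of_riemannHypothesis hRH
  exact ⟨ι, γ, fun g hg _ => hγ g hg⟩

/-- The planner's pair (seed, step) and the held ladder are the same statement (plain induction). [folklore] -/
theorem quietLadder_iff_seed_and_step :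
    (∀ n : ℕ, 2 ≤ n → QuietRung (Real.log n)) ↔
      (QuietRung (Real.log 2) ∧ ∀ n : ℕ, 2 ≤ n → QuietRung (Real.log n) → QuietRung (Real.log (n + 1))) := by
  constructor
  · intro hL
    refine ⟨by simpa using hL 2 le_rfl, fun n hn _ => ?_⟩
    simpa [Nat.cast_succ] using hL (n + 1) (by omega)
  · rintro ⟨hSeed, hStep⟩ n hn
    induction n, hn using Nat.le_induction with
    | base => simpa using hSeed
    | succ m hm ih => simpa [Nat.cast_succ] using hStep m hm ih

end Summit.RiemannHypothesis.RiemannHypothesis.Theorems.SpectralTraceWindowStep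

end
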